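import Summits.MatrixMultiplication.OmegaCensus.DominoZ11Z11Cover5A
import HarnessLib

/-!
# Kernel covers on `ZMod 11 × ZMod 11`: part `5` (B) (scaling-canonical table)

ω-census `pub-omega`, family (b3), seat pub-omega-group gen 20.  Framing: lottery ticket; floor = certified bounds/negative
ranges.  VALUE: the finite kernel computation behind the `ℤ_11 × ℤ_11` domino cell theorem with a part `5`
(`DominoZ11Z11Cells.lean`, census cell `(1,5,8)@121`); NOT progress on ω.  Normal form (i): 58 806 leaves / 180 991 nodes in
13 chunks (key `polyBE 2 R % 13`, ≤ 20 556 nodes each); files A (search tree, soundness, chunks 0–2), B (3–4), C (5–6),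
D (7–9), E (10–12, axis normal forms); B–E all import A only; the assembly `exists_table_entry_11_5` lives in `DominoZ11Z11Cells.lean`.  Exact Python twin: `pub-omega-group-g20/code/emulate2.py 11 5 13`.
-/

namespace Summit.MatrixMultiplication.OmegaCensus

namespace ZpZpDomino

set_option maxHeartbeats 4000000 in
/-- Kernel cover computation, `p = 11`, `d = 5`, normal form (i), chunk `3` of `13`. [folklore] -/
theorem cover_11_5_nf1_3 : coverNF1 11 5 passTreeZ11d5 2 13 3 = true := by decide +kernel

set_option maxHeartbeats 4000000 in
/-- Kernel cover computation, `p = 11`, `d = 5`, normal form (i), chunk `4` of `13`. [folklore] -/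
theorem cover_11_5_nf1_4 : coverNF1 11 5 passTreeZ11d5 2 13 4 = true := by decide +kernel

end ZpZpDomino

end Summit.MatrixMultiplication.OmegaCensus
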